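import Mathlib
import Summits.ResolutionOfSingularities.ResolutionOfSingularities.Theorems.WildQuotientsWildQuotientResolutionS1aInducedTorusUnits
import Summits.ResolutionOfSingularities.ResolutionOfSingularities.Theorems.WildQuotientsWildQuotientResolutionS1aInducedTorusFiniteType
import Summits.ResolutionOfSingularities.ResolutionOfSingularities.Theorems.IndSmoothValuativeSmoothingSmoothBlowupChart

/-!
# `InducedTorusStatement` from the regularity of the induced-torus ring (REAL reduction; one typed residual)
(crux stmt-ResolutionOfSingularities-17941 `WildQuotients.CyclicQuotientFourfolds`, line B `s1a-tamebr`, (S1)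
`S1.TameToBR.InducedTorusStatement` of `…S1aTameToBR`; plan-1 ASSIGN 2026-08-27T19:48:55Z. [OURS · L1 W4.5c] — NOT
statements of the manuscript; counted 0. Owner res-L1-w45c-stub-4 (gen 5).)

With `R := InducedTorus.InducedRing r 𝒜 = ⊕_λ 𝒜(λ mod r)` and its tautological `ℤᵐ`-grading (…S1aInducedTorusRing),
the units in all degrees `e • χ`, `e = [Π ZMod (r j) : closure s]` (…S1aInducedTorusUnits), the degree-`0` part `≅ 𝒜 0`
(ibid.) and finite type over `k` (…S1aInducedTorusFiniteType) are in the tree; smoothness over the perfect field `k`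
follows from REGULARITY of `R` (`ValuativeSmoothing.smooth_of_isRegularRing_of_perfectField`). This file records:
* `InducedTorus.InducedRingRegular` — THE ONE REMAINING TYPED STATEMENT (OURS `Prop`, not asserted): `R` is a regular
  ring whenever `B` is regular Noetherian (intended proof: faithfully flat descent along `R → B[y₁^{±1},…,y_m^{±1}]`,
  which is free over `R` with basis `y^{λ_δ}`, one lift `λ_δ` per residue `δ`; `isRegularRing_of_faithfullyFlat`,
  `MvPolynomial.isRegularRing_of_isRegularRing`, `isRegularRing_localization`);
* `InducedTorus.inducedTorus_of_regular : InducedRingRegular → S1.TameToBR.InducedTorusStatement` — REAL.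
The successor lands `…S1aInducedTorusRegular.lean` (`inducedRingRegular_holds`) and then the one-line
`…S1aInducedTorus.lean` (`inducedTorus_holds := inducedTorus_of_regular inducedRingRegular_holds`).
-/

set_option linter.dupNamespace false

noncomputable section

open DirectSum

namespace Summit.ResolutionOfSingularities.ResolutionOfSingularities.Theorems.WildQuotientResolution.S1.InducedTorus

/-- **The remaining typed statement (E)**: the induced-torus ring of a regular Noetherian graded algebra is a
regular ring. [OURS · L1 W4.5c] — a `Prop`, NOT asserted here. -/
def InducedRingRegular : Prop :=
  ∀ (k : Type) [Field k] (m : ℕ) (r : Fin m → ℕ) (B : Type) [CommRing B] [Algebra k B] [IsNoetherianRing B]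
    (𝒜 : (Π j : Fin m, ZMod (r j)) → Submodule k B) [GradedAlgebra 𝒜],
    IsRegularRing B → IsRegularRing (InducedRing r 𝒜)

/-- **(S1) from (E), REAL.** If the induced-torus ring is regular, then `S1.TameToBR.InducedTorusStatement` holds:
`R := InducedRing r 𝒜` with its tautological grading, `e := [Π ZMod (r j) : closure s]`, finite type, smooth
(regular of finite type over a perfect field), units in all degrees `e • χ`, and `R₀ ≃ₐ[k] 𝒜 0`. [OURS · L1 W4.5c] -/
theorem inducedTorus_of_regular (hE : InducedRingRegular) : S1.TameToBR.InducedTorusStatement := by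
  intro k _ _ m r B _ _ _ _ 𝒜 _ hreg s hs hfin
  haveI : Algebra.FiniteType k (InducedRing r 𝒜) := finiteType r 𝒜
  haveI : IsRegularRing (InducedRing r 𝒜) := hE k m r B 𝒜 hreg
  refine ⟨InducedRing r 𝒜, inferInstance, inferInstance, grade r 𝒜, inferInstance,
    (AddSubgroup.closure (s : Set (Π j : Fin m, ZMod (r j)))).index,
    Nat.pos_of_ne_zero hfin.index_ne_zero, inferInstance,
    ValuativeSmoothing.smooth_of_isRegularRing_of_perfectField k (InducedRing r 𝒜),
    fun χ => exists_unit_grade_nsmul r 𝒜 s hs χ, ⟨zeroEquiv r 𝒜⟩⟩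

end Summit.ResolutionOfSingularities.ResolutionOfSingularities.Theorems.WildQuotientResolution.S1.InducedTorus

end
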